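import Summits.ResolutionOfSingularities.ResolutionOfSingularities.Theorems.FrobeniusLadderFRationalResolutionGaloisBaseChangeRegular
import Summits.ResolutionOfSingularities.ResolutionOfSingularities.Theorems.FrobeniusLadderFRationalResolutionGaloisFibre
import Summits.ResolutionOfSingularities.ResolutionOfSingularities.Theorems.FrobeniusLadderFRationalResolutionBlowupRegularFlatChartAway
import HarnessLib

/-!
# Crux `FrobeniusLadder.FRationalResolution` (stmt-ResolutionOfSingularities-15317), line `redirect`,
# stub `stub_diagonalizableQuotientResolution` — THE GALOIS ROUTE WITH `hreg` READ IN THE COMPLETE LOCAL RING `Ê = (B'_{𝔔'})^`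

`…GaloisBaseChangeRegular.hloc_of_decomposition_stable_piece'` (✓ p833582) asks for the regularity of `Bl_{I B'_g}(Spec B'_g)` for
SOME `g ∉ 𝔔'` (`B' = B ⊗_K K'`, `𝔔'` a maximal ideal over the isolated singular point `𝔭`, `I` a decomposition-stable `𝔔'`-primary
piece). The analysis of the twisted case (memos MEMO-15317-leafhand2-g13 §3b, -g14 §2, -g15 §2) takes place in the complete local ring
`Ê = (B'_{𝔔'})^`, a `K`-form of the split toric germ. This file closes the gap between the two («completion step», g15 §3 (S2)):

* `exists_not_mem_forall_mem_of_comap_eq` — an element `g ∉ 𝔔'` lying in EVERY OTHER prime of `B ⊗_K K'` over `𝔭` (the fibre is one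
  finite Galois orbit of maximal ideals, `…GaloisFibre`; prime avoidance for their product);
* **`hloc_of_decomposition_stable_piece_of_adicCompletion`** — `hloc` at `ι 𝔭` from the one-point data `(K', 𝔔', I, n, hD)` and
  `Bl_{I Ê}(Spec Ê)` regular, `Ê = AdicCompletion 𝔪 (B'_{𝔔'})` (via `…BlowupRegularFlatChartAway.isRegular_affineBlowup_away_of_adicCompletion_atPrime`:
  `D(g) ∖ {𝔔'}` is regular because its points do not lie over `𝔭`, EGA IV 17.5.8 (iii) ascent `…mem_regularLocus_baseChange`);
* `hasResolution_of_decomposition_stable_pieces_of_adicCompletion` — the scheme-side assembly with the same replacement.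

Honest label: plumbing toward ONE leaf stub (no stub, crux or summit closed); what remains is the decomposition-stability `hD` and the
regularity of ONE blow-up of the complete local ring `Ê`. No definitions, no named facts, no sorry.
[cite: Matsumura1987, Thm. 8.14; Thm. 23.7 (i)] [cite: GortzWedhorn2020, Prop. 13.91 (2)] [cite: StacksProject, Tag 09EB; Tag 0CDQ]
[cite: Grothendieck1967, Prop. 17.5.8 (iii)]
-/

noncomputable section

-- single-problem summit: the doubled namespace component is forced
set_option linter.dupNamespace false

open CategoryTheory AlgebraicGeometry TopologicalSpace TensorProduct
open Literature.AlgebraicGeometry.Resolution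
open Summit.ResolutionOfSingularities.ResolutionOfSingularities.Theorems.FRationalResolution

namespace Summit.ResolutionOfSingularities.ResolutionOfSingularities.Theorems.FRationalResolution.GaloisBaseChangeRegularCompletion

/-- **An element isolating `𝔔'` in the fibre over `𝔭`.** For `K'/K` finite Galois, `𝔭 ⊆ B` and `𝔔' ⊆ B ⊗_K K'` MAXIMAL over
`𝔭`, there is `g ∉ 𝔔'` lying in every other prime of `B ⊗_K K'` over `𝔭` (these are the finitely many Galois translates
`(1 ⊗ σ) 𝔔' ≠ 𝔔'`, all maximal; take `g` in their product outside `𝔔'`). [cite: StacksProject, Tag 09EB; Tag 00DS] -/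
theorem exists_not_mem_forall_mem_of_comap_eq (K K' B : Type) [Field K] [Field K'] [Algebra K K'] [FiniteDimensional K K']
    [IsGalois K K'] [CommRing B] [Algebra K B] (𝔭 : Ideal B) (𝔔' : Ideal (B ⊗[K] K'))
    [h𝔔' : 𝔔'.IsMaximal] (h𝔔'𝔭 : 𝔔'.comap (algebraMap B (B ⊗[K] K')) = 𝔭) :
    ∃ g : B ⊗[K] K', g ∉ 𝔔' ∧ ∀ (Q : Ideal (B ⊗[K] K')) [Q.IsPrime],
      Q.comap (algebraMap B (B ⊗[K] K')) = 𝔭 → Q ≠ 𝔔' → g ∈ Q := by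
  classical
  -- the twists `1 ⊗ σ` are bijective, so the translates of `𝔔'` are maximal
  let tw : (K' ≃ₐ[K] K') → (B ⊗[K] K' →ₐ[B] B ⊗[K] K') := fun σ =>
    Algebra.TensorProduct.map (AlgHom.id B B) (σ : K' →ₐ[K] K')
  have hbij : ∀ σ, Function.Bijective (tw σ) := by
    intro σ
    have heq : (tw σ : B ⊗[K] K' → B ⊗[K] K') =
        (Algebra.TensorProduct.congr (AlgEquiv.refl : B ≃ₐ[B] B) σ : B ⊗[K] K' → B ⊗[K] K') := by
      funext x
      induction x using TensorProduct.induction_on with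
      | zero => simp [tw]
      | tmul b y => simp [tw, Algebra.TensorProduct.map_tmul]
      | add x y hx hy => simp only [map_add, hx, hy]
    rw [heq]
    exact (Algebra.TensorProduct.congr (AlgEquiv.refl : B ≃ₐ[B] B) σ).bijective
  have hmax : ∀ σ, (𝔔'.map (tw σ)).IsMaximal := fun σ => Ideal.IsMaximal.map_bijective (tw σ) (hbij σ) h𝔔'
  -- the product of the translates different from `𝔔'` is not inside `𝔔'`
  let S : Finset (K' ≃ₐ[K] K') := Finset.univ.filter fun σ => 𝔔'.map (tw σ) ≠ 𝔔'
  have hnot : ¬ S.prod (fun σ => 𝔔'.map (tw σ)) ≤ 𝔔' := by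
    intro hle
    obtain ⟨σ, hσS, hσ⟩ := (Ideal.IsPrime.prod_le h𝔔'.isPrime').mp hle
    have hne : 𝔔'.map (tw σ) ≠ 𝔔' := (Finset.mem_filter.mp hσS).2
    exact hne ((hmax σ).eq_of_le h𝔔'.ne_top hσ)
  obtain ⟨g, hgP, hg𝔔⟩ := SetLike.not_le_iff_exists.mp hnot
  refine ⟨g, hg𝔔, fun Q _ hQ hQne => ?_⟩
  -- every prime over `𝔭` is a translate of `𝔔'`
  obtain ⟨σ, hσ⟩ := GaloisFibre.exists_eq_map_twist_of_comap_eq 𝔭 𝔔' h𝔔'𝔭 Q hQ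
  have hσS : σ ∈ S := Finset.mem_filter.mpr ⟨Finset.mem_univ _, fun h => hQne (hσ.trans h)⟩
  rw [hσ]
  exact (Ideal.prod_le_inf.trans (Finset.inf_le hσS)) hgP

/-- **`hloc` from ONE decomposition-stable primary piece whose blow-up is regular ON THE COMPLETE LOCAL RING.** As
`…GaloisBaseChangeRegular.hloc_of_decomposition_stable_piece'`, with `hreg : ∃ g ∉ 𝔔', Bl_{I B'_g}` regular REPLACED by the regularity
of `Bl_{I Ê}(Spec Ê)`, `Ê = ((B ⊗_K K')_{𝔔'})^` the adic completion of the local ring at `𝔔'`.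
[cite: Matsumura1987, Thm. 8.14; Thm. 23.7 (i)] [cite: GortzWedhorn2020, Prop. 13.91 (2)] [cite: Grothendieck1967, Prop. 17.5.8 (iii)]
[cite: StacksProject, Tag 0CDQ; Tag 09EB] [cite: Kollar2007, §2.2] -/
theorem hloc_of_decomposition_stable_piece_of_adicCompletion (K : Type) [Field K] (X : Scheme.{0}) [IsIntegral X]
    (f : X ⟶ Spec (.of K)) [LocallyOfFiniteType f]
    {B : Type} [CommRing B] [IsDomain B] [Algebra K B] [Algebra.FiniteType K B]
    (ι : Spec (.of B) ⟶ X) [IsOpenImmersion ι] (hι : ι ≫ f = Spec.map (CommRingCat.ofHom (algebraMap K B)))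
    (𝔭 : Ideal B) [h𝔭 : 𝔭.IsMaximal] (h𝔭0 : 𝔭 ≠ ⊥)
    (hsing : ι ⟨𝔭, h𝔭.isPrime⟩ ∉ Scheme.regularLocus X)
    (hregB : ∀ P : Spec (.of B), P.asIdeal ≠ 𝔭 → P ∈ Scheme.regularLocus (Spec (.of B)))
    (K' : Type) [Field K'] [Algebra K K'] [FiniteDimensional K K'] [IsGalois K K']
    (𝔔' : Ideal (B ⊗[K] K')) [h𝔔' : 𝔔'.IsMaximal] (h𝔔'𝔭 : 𝔔'.comap (algebraMap B (B ⊗[K] K')) = 𝔭)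
    (I : Ideal (B ⊗[K] K')) {n : ℕ} (hpI : 𝔔' ^ n ≤ I) (hIp : I ≤ 𝔔')
    (hD : ∀ σ : K' ≃ₐ[K] K',
      𝔔'.map (Algebra.TensorProduct.map (AlgHom.id B B) (σ : K' →ₐ[K] K')) = 𝔔' →
      I.map (Algebra.TensorProduct.map (AlgHom.id B B) (σ : K' →ₐ[K] K')) ≤ I)
    (hreg : Scheme.IsRegular (affineBlowup ((I.map (algebraMap (B ⊗[K] K') (Localization.AtPrime 𝔔'))).map
      (algebraMap (Localization.AtPrime 𝔔')
        (AdicCompletion (IsLocalRing.maximalIdeal (Localization.AtPrime 𝔔')) (Localization.AtPrime 𝔔')))))) :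
    ∃ (V : X.Opens), ι ⟨𝔭, h𝔭.isPrime⟩ ∈ V ∧
      (∀ t : X, t ∉ Scheme.regularLocus X → t ∈ V → t = ι ⟨𝔭, h𝔭.isPrime⟩) ∧
      ∃ (Y : Scheme.{0}) (ρ : Y ⟶ V), IsProper ρ ∧ Scheme.IsRegular Y ∧
        IsIso (ρ ∣_ (V.ι ⁻¹ᵁ ⟨Scheme.regularLocus X, isOpen_regularLocus_of_locallyOfFiniteType_field f⟩)) ∧
        Dense ((ρ ⁻¹ᵁ (V.ι ⁻¹ᵁ ⟨Scheme.regularLocus X,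
          isOpen_regularLocus_of_locallyOfFiniteType_field f⟩) : Y.Opens) : Set Y) := by
  haveI : IsNoetherianRing B := Algebra.FiniteType.isNoetherianRing K B
  haveI : Algebra.FiniteType B (B ⊗[K] K') := inferInstance
  haveI : IsNoetherianRing (B ⊗[K] K') := Algebra.FiniteType.isNoetherianRing B (B ⊗[K] K')
  -- isolate `𝔔'` among the primes over `𝔭`
  obtain ⟨g, hg𝔔, hg⟩ := exists_not_mem_forall_mem_of_comap_eq K K' B 𝔭 𝔔' h𝔔'𝔭
  -- `D(g) ∖ {𝔔'}` is regular: its points do not lie over `𝔭`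
  have hoff : ∀ x : Spec (.of (B ⊗[K] K')), x.asIdeal ≠ 𝔔' → g ∉ x.asIdeal →
      x ∈ Scheme.regularLocus (Spec (.of (B ⊗[K] K'))) := by
    intro x hx hgx
    by_cases hx𝔭 : x.asIdeal.comap (algebraMap B (B ⊗[K] K')) = 𝔭
    · exact absurd (hg x.asIdeal hx𝔭 hx) hgx
    · exact GaloisBaseChangeRegular.mem_regularLocus_baseChange K K' B x (hregB ⟨_, inferInstance⟩ hx𝔭)
  exact GaloisBaseChangeRegular.hloc_of_decomposition_stable_piece' K X f ι hι 𝔭 h𝔭0 hsing hregB K' 𝔔' h𝔔'𝔭 I hpI hIp hD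
    ⟨g, hg𝔔, BlowupRegularFlatChartAway.isRegular_affineBlowup_away_of_adicCompletion_atPrime 𝔔' I hpI hIp hg𝔔 hoff hreg⟩

/-- **THE GALOIS ROUTE, SCHEME SIDE, with the blow-up regularity read in the complete local rings.** As
`…GaloisBaseChangeRegular.hasResolution_of_decomposition_stable_pieces'` with, at each singular point, `Bl_{I Ê}(Spec Ê)` regular
(`Ê = ((B ⊗_K K')_{𝔔'})^`) in place of `∃ g ∉ 𝔔', Bl_{I (B ⊗_K K')_g}` regular. [cite: StacksProject, Tag 0CDQ; Tag 09EB]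
[cite: Kollar2007, §2.2] [cite: Matsumura1987, Thm. 8.14] -/
theorem hasResolution_of_decomposition_stable_pieces_of_adicCompletion (K : Type) [Field K] (X : Scheme.{0}) [IsIntegral X]
    (f : X ⟶ Spec (.of K)) [LocallyOfFiniteType f] (hfin : (Scheme.regularLocus X)ᶜ.Finite)
    (hchart : ∀ s : X, s ∉ Scheme.regularLocus X →
      ∃ (B : Type) (_ : CommRing B) (_ : IsDomain B) (_ : Algebra K B) (_ : Algebra.FiniteType K B)
        (ι : Spec (.of B) ⟶ X) (_ : IsOpenImmersion ι)
        (_ : ι ≫ f = Spec.map (CommRingCat.ofHom (algebraMap K B)))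
        (𝔭 : Ideal B) (h𝔭 : 𝔭.IsMaximal) (_ : 𝔭 ≠ ⊥) (_ : ι ⟨𝔭, h𝔭.isPrime⟩ = s)
        (_ : ∀ P : Spec (.of B), P.asIdeal ≠ 𝔭 → P ∈ Scheme.regularLocus (Spec (.of B)))
        (K' : Type) (_ : Field K') (_ : Algebra K K') (_ : FiniteDimensional K K') (_ : IsGalois K K')
        (𝔔' : Ideal (B ⊗[K] K')) (_ : 𝔔'.IsMaximal) (I : Ideal (B ⊗[K] K')) (n : ℕ),
          𝔔'.comap (algebraMap B (B ⊗[K] K')) = 𝔭 ∧ 𝔔' ^ n ≤ I ∧ I ≤ 𝔔' ∧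
          (∀ σ : K' ≃ₐ[K] K',
            𝔔'.map (Algebra.TensorProduct.map (AlgHom.id B B) (σ : K' →ₐ[K] K')) = 𝔔' →
            I.map (Algebra.TensorProduct.map (AlgHom.id B B) (σ : K' →ₐ[K] K')) ≤ I) ∧
          Scheme.IsRegular (affineBlowup ((I.map (algebraMap (B ⊗[K] K') (Localization.AtPrime 𝔔'))).map
            (algebraMap (Localization.AtPrime 𝔔')
              (AdicCompletion (IsLocalRing.maximalIdeal (Localization.AtPrime 𝔔')) (Localization.AtPrime 𝔔')))))) :
    Scheme.HasResolution X := by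
  refine IsolatedGlue.hasResolution_of_finite_singularLocus_of_local K X f hfin fun s hs => ?_
  obtain ⟨B, _, _, _, _, ι, _, hι, 𝔭, h𝔭, h𝔭0, hιs, hregB, K', _, _, _, _, 𝔔', _, I, n, h𝔔'𝔭, hpI, hIp, hD, hreg⟩ :=
    hchart s hs
  subst hιs
  exact hloc_of_decomposition_stable_piece_of_adicCompletion K X f ι hι 𝔭 h𝔭0 hs hregB K' 𝔔' h𝔔'𝔭 I hpI hIp hD hreg

end Summit.ResolutionOfSingularities.ResolutionOfSingularities.Theorems.FRationalResolution.GaloisBaseChangeRegularCompletion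

end
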